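import Mathlib
import Summits.ResolutionOfSingularities.ResolutionOfSingularities.Theorems.HomologicalConductorPersistenceGradedTransferCoinduced
import Literature.RingTheory.IntegralClosure.KrullIntersection
import HarnessLib

/-!
# Rung S-2 `PersistenceSurface` (stmt-ResolutionOfSingularities-19970) — the REYNOLDS-FREE TRANSFER, part 3: the
# PERFECT PAIRING `φ = ρ(· w)` from a finite GRADING of a normal domain, and the graded T-V floor with standard
# hypotheses (every characteristic; stub-4's part 11 without characters)

Route `ResolutionOfSingularities/HomologicalConductor`, chain W4.4b (cell res-hironaka; seat res-L1-w44b-stub-1 gen 6).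
`[OURS · L1 w44b]` replaces the role of no printed item; NOT a statement of the manuscript under review (Hironaka
2017), nothing here is attributed to its author; folklore algebra, AI-written (weaker than expert review).

## Content

`U → V` with `algebraMap` injective, `V` a noetherian NORMAL DOMAIN, finitely graded over `U = V₀` by `U`-linear
projectors `eₓ` (`x ∈ G`, `G` a finite additive group): `∑ₓ eₓ = id`, `eₓ e_y = δ_{xy} e_y`, `V_x V_y ⊆ V_{x+y}`,
`e₀ 1 = 1`, `V₀ = algebraMap(U)` realised by `ρ : V → U` (`algebraMap (ρ v) = e₀ v`); and **(BIG)**: for every `x` and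
every height-one prime `P ⊂ V` some element of `V_x` avoids `P` (a diagonal grading on a graded two-dimensional normal
domain with `V₀ = k`: the weights act freely off the vertex).

* `proj_mul_eq_of_graded` — `e_d(m · w) = m · e_{d−x}(w)` for `m ∈ V_x`; `proj_pow_of_graded` — `m ∈ V_x ⇒ mᵏ ∈ V_{k•x}`.
* `exists_eq_mul_of_degree` — every `U`-linear `φ : V → U` is a MULTIPLICATION on each graded piece:
  `φ(m) = m · y_x` for `m ∈ V_x`, with `y_x ∈ V_{−x}` (`m₀ φ(m) = m φ(m₀)` through the degree-`0` elements
  `m₀^{|G|−1} m`, `m₀^{|G|}`; the fraction `φ(m₀)/m₀` lies in every `V_P`, `ht P = 1`, hence in `V` — Krull, tree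
  `Literature.RingTheory.IntegralClosure.exists_algebraMap_eq_of_forall_height_eq_one`).
* **`pairing_existsUnique_of_graded`** — PERFECT PAIRING: every `φ` is `v ↦ ρ(v w)` for a UNIQUE `w` (`w = ∑ₓ y_x`;
  uniqueness: `e₀(q^{|G|−1} δ) = q^{|G|}` for `q = eₓ δ`) — with NO `|G| ∈ Uˣ`.
* `finite_projective_coind_of_graded` — hence the Frobenius hypothesis (`Hom_U(V, U) ≅ V`,
  `PersistenceCyclicTransferSyzygy.finite_projective_of_reynoldsPairing`).
* **`mul_mem_cohomologyAnnihilatorOfDegree_three_of_graded`**, `mul_mem_cohomologyAnnihilator_of_graded` — the graded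
  T-V FLOOR with standard hypotheses: `U` noetherian, `c ∈ ca³(V)`, `a = ∑ₖ bₖ b′ₖ` with `b′ₖ ∈ V_{−x}` for every `x`,
  `algebraMap u = a c` ⇒ **`u ∈ ca³(U) ⊆ ca(U)`** — in EVERY characteristic (`p ∣ |G|` included).

References (mechanism only): S. B. Iyengar, R. Takahashi, IMRN 2016, arXiv:1404.1476, Remark 2.13
[`IyengarTakahashi2014`]; Matsumura, *Commutative Ring Theory*, Thm 11.5 (`⋂_{ht 1} R_P = R`); M. Auslander,
Trans. AMS 293 (1986).
-/

noncomputable section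

-- single-problem summit: the doubled namespace component `ResolutionOfSingularities` is forced
set_option linter.dupNamespace false

namespace Summit.ResolutionOfSingularities.ResolutionOfSingularities.Theorems.HomologicalConductor.PersistenceGradedTransfer

open Finset CategoryTheory Literature.RingTheory.CohomologyAnnihilator
open Summit.ResolutionOfSingularities.ResolutionOfSingularities.Theorems.NoZeno.SandwichCluster
open Summit.ResolutionOfSingularities.ResolutionOfSingularities.Theorems.HomologicalConductor.PersistenceCyclicTransferSyzygy

universe u

variable {U V : Type u} [CommRing U] [CommRing V] [Algebra U V]
variable {G : Type*} [AddCommGroup G] [Fintype G] [DecidableEq G]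

/-! ## Degree bookkeeping -/

/-- **Shift lemma**: for `m ∈ V_x`, `e_d(m · w) = m · e_{d−x}(w)`. [folklore] -/
theorem proj_mul_eq_of_graded (e : G → (V →ₗ[U] V)) (he_sum : ∀ w, ∑ x, e x w = w)
    (he_proj : ∀ x y w, e x (e y w) = if x = y then e y w else 0)
    (he_mul : ∀ x y (v w : V), e x v = v → e y w = w → e (x + y) (v * w) = v * w)
    {x : G} {m : V} (hm : e x m = m) (d : G) (w : V) : e d (m * w) = m * e (d - x) w := by
  conv_lhs => rw [← he_sum w, mul_sum, map_sum]
  have hterm : ∀ y, e d (m * e y w) = if y = d - x then m * e (d - x) w else 0 := by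
    intro y
    have hy : e y (e y w) = e y w := by rw [he_proj, if_pos rfl]
    have hhom : e (x + y) (m * e y w) = m * e y w := he_mul x y m (e y w) hm hy
    by_cases hyd : y = d - x
    · subst hyd
      rw [add_sub_cancel] at hhom
      rw [if_pos rfl, hhom]
    · have h0 := he_proj d (x + y) (m * e y w)
      rw [hhom] at h0
      rw [h0, if_neg hyd, if_neg]
      intro h
      apply hyd
      rw [h, add_sub_cancel_left]
  simp only [hterm, sum_ite_eq', mem_univ, if_true]

omit [Fintype G] [DecidableEq G] in
/-- `m ∈ V_x ⇒ mᵏ ∈ V_{k • x}` (given `e₀ 1 = 1`). [folklore] -/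
theorem proj_pow_of_graded (e : G → (V →ₗ[U] V)) (he_one : e 0 1 = 1)
    (he_mul : ∀ x y (v w : V), e x v = v → e y w = w → e (x + y) (v * w) = v * w)
    {x : G} {m : V} (hm : e x m = m) : ∀ k : ℕ, e (k • x) (m ^ k) = m ^ k
  | 0 => by rw [zero_smul, pow_zero, he_one]
  | k + 1 => by
    rw [succ_nsmul, pow_succ]
    exact he_mul _ _ _ _ (proj_pow_of_graded e he_one he_mul hm k) hm

/-! ## A linear form is a multiplication on each graded piece -/

section Normal

variable [IsDomain V] [IsNoetherianRing V] [IsIntegrallyClosed V]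

/-- **A `U`-linear form is a multiplication on each graded piece.**  `V` a noetherian normal domain, finitely graded
over `U = V₀`; if some element of `V_x` avoids each height-one prime, then for every `U`-linear `φ : V → U` there is
`y ∈ V_{−x}` with `φ(m) = m·y` for all `m ∈ V_x`.  (`m₀ φ(m) = m φ(m₀)` via the degree-`0` elements `m₀^{|G|−1} m`,
`m₀^{|G|}`; `φ(m₀)/m₀ ∈ ⋂_{ht P = 1} V_P = V`.) [folklore] -/
theorem exists_eq_mul_of_degree (e : G → (V →ₗ[U] V)) (he_sum : ∀ w, ∑ x, e x w = w)
    (he_proj : ∀ x y w, e x (e y w) = if x = y then e y w else 0)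
    (he_mul : ∀ x y (v w : V), e x v = v → e y w = w → e (x + y) (v * w) = v * w) (he_one : e 0 1 = 1)
    (he_zero : ∀ v, e 0 v = v → ∃ r : U, algebraMap U V r = v) (x : G)
    (hbig : ∀ P : Ideal V, P.IsPrime → P.height = 1 → ∃ m : V, e x m = m ∧ m ∉ P)
    (φ : ((ModuleCat.restrictScalars (algebraMap U V)).obj (ModuleCat.of V V)) →ₗ[U] U) :
    ∃ y : V, e (-x) y = y ∧ ∀ m : V, e x m = m → algebraMap U V (φ m) = m * y := by
  classical
  set n := Fintype.card G with hn'
  have hn : 0 < n := Fintype.card_pos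
  let toW : V → ((ModuleCat.restrictScalars (algebraMap U V)).obj (ModuleCat.of V V)) := fun v => v
  have hφW : ∀ m : V, φ m = φ (toW m) := fun _ => rfl
  rcases em (∃ m₀ : V, e x m₀ = m₀ ∧ m₀ ≠ 0) with ⟨m₀, hm₀, hm₀ne⟩ | hzero
  swap
  · have hz : ∀ m : V, e x m = m → m = 0 := fun m hm => by
      by_contra hne
      exact hzero ⟨m, hm, hne⟩
    refine ⟨0, by rw [map_zero], fun m hm => ?_⟩
    rw [hz m hm, hφW, show toW 0 = 0 from rfl, map_zero, map_zero, zero_mul]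
  -- degree-`0` elements `m₀^{n-1} m` and `m₀^n`
  have hdeg1 : ∀ m : V, e x m = m → e 0 (m₀ ^ (n - 1) * m) = m₀ ^ (n - 1) * m := by
    intro m hm
    have h := he_mul _ _ _ _ (proj_pow_of_graded e he_one he_mul hm₀ (n - 1)) hm
    rwa [← succ_nsmul, Nat.sub_add_cancel hn, hn', card_nsmul_eq_zero] at h
  have hdeg0 : e 0 (m₀ ^ n) = m₀ ^ n := by
    have h := proj_pow_of_graded e he_one he_mul hm₀ n
    rwa [hn', card_nsmul_eq_zero] at h
  -- `m₀ φ(m) = m φ(m₀)` on the piece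
  have key : ∀ m : V, e x m = m → m₀ * algebraMap U V (φ (toW m)) = m * algebraMap U V (φ (toW m₀)) := by
    intro m hm
    obtain ⟨u₁, hu₁'⟩ := he_zero _ (hdeg1 m hm)
    obtain ⟨u₀, hu₀'⟩ := he_zero _ hdeg0
    have hsm : u₀ • toW m = u₁ • toW m₀ := by
      change toW (algebraMap U V u₀ * m) = toW (algebraMap U V u₁ * m₀)
      rw [hu₀', hu₁', mul_right_comm, ← pow_succ, Nat.sub_add_cancel hn]
    have h1 : u₀ * φ (toW m) = u₁ * φ (toW m₀) := by
      rw [← smul_eq_mul, ← smul_eq_mul, ← map_smul, ← map_smul, hsm]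
    have h2 := congrArg (algebraMap U V) h1
    rw [map_mul, map_mul, hu₀', hu₁'] at h2
    have h3 : m₀ ^ (n - 1) * (m₀ * algebraMap U V (φ (toW m)) - m * algebraMap U V (φ (toW m₀))) = 0 := by
      rw [mul_sub, ← mul_assoc, ← pow_succ, Nat.sub_add_cancel hn, h2]
      ring
    exact sub_eq_zero.mp ((mul_eq_zero.mp h3).resolve_left (pow_ne_zero _ hm₀ne))
  -- the fraction `φ(m₀)/m₀` lies in `V`
  let K := FractionRing V
  have hm₀K : algebraMap V K m₀ ≠ 0 := IsFractionRing.to_map_eq_zero_iff.not.mpr hm₀ne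
  let f : K := algebraMap V K (algebraMap U V (φ (toW m₀))) / algebraMap V K m₀
  have hfm : ∀ m : V, e x m = m → algebraMap V K m * f = algebraMap V K (algebraMap U V (φ (toW m))) := by
    intro m hm
    change algebraMap V K m * (algebraMap V K (algebraMap U V (φ (toW m₀))) / algebraMap V K m₀) = _
    rw [div_eq_mul_inv, ← mul_assoc, ← map_mul, ← key m hm, map_mul, mul_right_comm, mul_inv_cancel₀ hm₀K,
      one_mul]
  obtain ⟨y, hy⟩ := Literature.RingTheory.IntegralClosure.exists_algebraMap_eq_of_forall_height_eq_one
    (R := V) (K := K) f fun P hP hP1 => by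
      obtain ⟨m, hm, hmP⟩ := hbig P hP hP1
      exact ⟨m, hmP, algebraMap U V (φ (toW m)), hfm m hm⟩
  have hmul : ∀ m : V, e x m = m → algebraMap U V (φ (toW m)) = m * y := by
    intro m hm
    apply IsFractionRing.injective V K
    rw [map_mul, hy, hfm m hm]
  refine ⟨y, ?_, fun m hm => by rw [hφW]; exact hmul m hm⟩
  -- degree of `y`: `m₀ y ∈ V₀` with `m₀ ∈ V_x` forces `y ∈ V_{−x}`
  have h0 : e 0 (m₀ * y) = m₀ * y := by
    obtain ⟨r, hr⟩ : ∃ r : U, algebraMap U V r = m₀ * y := ⟨φ (toW m₀), hmul m₀ hm₀⟩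
    have : e 0 (algebraMap U V r) = algebraMap U V r := by
      rw [Algebra.algebraMap_eq_smul_one, LinearMap.map_smul_of_tower, he_one]
    rw [← hr, this]
  have h1 : e 0 (m₀ * y) = m₀ * e (0 - x) y := proj_mul_eq_of_graded e he_sum he_proj he_mul hm₀ 0 y
  rw [zero_sub] at h1
  have h2 : m₀ * (e (-x) y - y) = 0 := by rw [mul_sub, ← h1, h0, sub_self]
  exact sub_eq_zero.mp ((mul_eq_zero.mp h2).resolve_left hm₀ne)

/-- **PERFECT PAIRING from a grading.**  `V` a noetherian normal domain, finitely graded over `U = V₀` with (BIG),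
`algebraMap` injective, `ρ : V → U` the degree-`0` part (`algebraMap (ρ v) = e₀ v`).  Then every `U`-linear
`φ : V → U` is `v ↦ ρ(v w)` for a UNIQUE `w ∈ V` — with NO `|G| ∈ Uˣ`.  (Existence: `w = ∑ₓ y_x`; uniqueness: if
`ρ(v δ) = 0` for all `v` then for `q = eₓ δ`: `e₀(q^{|G|−1} δ) = q^{|G|} = 0`.) [this work] -/
theorem pairing_existsUnique_of_graded (e : G → (V →ₗ[U] V)) (he_sum : ∀ w, ∑ x, e x w = w)
    (he_proj : ∀ x y w, e x (e y w) = if x = y then e y w else 0)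
    (he_mul : ∀ x y (v w : V), e x v = v → e y w = w → e (x + y) (v * w) = v * w) (he_one : e 0 1 = 1)
    (he_zero : ∀ v, e 0 v = v → ∃ r : U, algebraMap U V r = v) (hinj : Function.Injective (algebraMap U V))
    (hbig : ∀ (x : G) (P : Ideal V), P.IsPrime → P.height = 1 → ∃ m : V, e x m = m ∧ m ∉ P)
    (ρ : V →ₗ[U] U) (hρ : ∀ v, algebraMap U V (ρ v) = e 0 v)
    (φ : ((ModuleCat.restrictScalars (algebraMap U V)).obj (ModuleCat.of V V)) →ₗ[U] U) :
    ∃! w : V, ∀ v : V, φ v = ρ (v * w) := by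
  classical
  set n := Fintype.card G with hn'
  have hn : 0 < n := Fintype.card_pos
  let toW : V → ((ModuleCat.restrictScalars (algebraMap U V)).obj (ModuleCat.of V V)) := fun v => v
  have hφW : ∀ m : V, φ m = φ (toW m) := fun _ => rfl
  have hex : ∀ x v, e x (e x v) = e x v := fun x v => by rw [he_proj, if_pos rfl]
  -- the multipliers `y_x ∈ V_{−x}`
  choose y hydeg hy using fun x : G =>
    exists_eq_mul_of_degree e he_sum he_proj he_mul he_one he_zero x (hbig x) φ
  -- `e₀ (e_x v · y_{x'}) = δ_{x x'} e_x v · y_x`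
  have hcross : ∀ x x' v, e 0 (e x v * y x') = if x' = x then e x v * y x else 0 := by
    intro x x' v
    rw [proj_mul_eq_of_graded e he_sum he_proj he_mul (hex x v) 0 (y x'), zero_sub]
    by_cases h : x' = x
    · subst h; rw [hydeg, if_pos rfl]
    · have h1 : e (-x) (y x') = 0 := by
        have := he_proj (-x) (-x') (y x')
        rw [hydeg x'] at this
        rw [this, if_neg (fun h' => h (neg_injective h').symm)]
      rw [h1, mul_zero, if_neg h]
  -- existence: `w = ∑ y_x`
  let w : V := ∑ x, y x
  have hpair : ∀ v : V, φ v = ρ (v * w) := by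
    intro v
    apply hinj
    have hL : algebraMap U V (φ v) = ∑ x, e x v * y x := by
      conv_lhs => rw [hφW, show toW v = ∑ x, toW (e x v) by
        change v = ∑ x, e x v; exact (he_sum v).symm]
      rw [map_sum, map_sum]
      exact sum_congr rfl fun x _ => hy x (e x v) (hex x v)
    have hR : algebraMap U V (ρ (v * w)) = ∑ x, e x v * y x := by
      rw [hρ]
      conv_lhs => rw [← he_sum v]
      rw [sum_mul, map_sum]
      refine sum_congr rfl fun x _ => ?_
      change e 0 (e x v * ∑ x', y x') = e x v * y x
      rw [mul_sum, map_sum]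
      simp only [hcross, sum_ite_eq', mem_univ, if_true]
    rw [hL, hR]
  refine ⟨w, hpair, fun w' hw' => ?_⟩
  -- uniqueness
  set δ := w' - w with hδ
  have hzero : ∀ v : V, e 0 (v * δ) = 0 := fun v => by
    rw [← hρ, hδ, mul_sub, map_sub, ← hw' v, ← hpair v, sub_self, map_zero]
  have hcomp : ∀ x, e x δ = 0 := by
    intro x
    set q := e x δ with hq
    have hqx : e x q = q := hex x δ
    have hpow : e ((n - 1) • x) (q ^ (n - 1)) = q ^ (n - 1) := proj_pow_of_graded e he_one he_mul hqx (n - 1)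
    -- `-((n-1)•x) = x` since `n•x = 0`
    have hneg : -((n - 1) • x) = x := by
      have : (n - 1) • x + x = 0 := by rw [← succ_nsmul, Nat.sub_add_cancel hn, hn', card_nsmul_eq_zero]
      exact neg_eq_iff_add_eq_zero.mpr this
    have h1 : e 0 (q ^ (n - 1) * δ) = q ^ (n - 1) * q := by
      rw [proj_mul_eq_of_graded e he_sum he_proj he_mul hpow 0 δ, zero_sub, hneg, ← hq]
    rw [hzero, ← pow_succ, Nat.sub_add_cancel hn] at h1
    exact (pow_eq_zero_iff (Nat.pos_iff_ne_zero.mp hn)).mp h1.symm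
  have : δ = 0 := by rw [← he_sum δ]; exact sum_eq_zero fun x _ => hcomp x
  rw [hδ, sub_eq_zero] at this
  exact this

/-- **The Frobenius hypothesis from a grading**: under the hypotheses of `pairing_existsUnique_of_graded`, `Hom_U(V, U)`
is a finitely generated projective `V`-module (indeed `≅ V`). [this work] -/
theorem finite_projective_coind_of_graded (e : G → (V →ₗ[U] V)) (he_sum : ∀ w, ∑ x, e x w = w)
    (he_proj : ∀ x y w, e x (e y w) = if x = y then e y w else 0)
    (he_mul : ∀ x y (v w : V), e x v = v → e y w = w → e (x + y) (v * w) = v * w) (he_one : e 0 1 = 1)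
    (he_zero : ∀ v, e 0 v = v → ∃ r : U, algebraMap U V r = v) (hinj : Function.Injective (algebraMap U V))
    (hbig : ∀ (x : G) (P : Ideal V), P.IsPrime → P.height = 1 → ∃ m : V, e x m = m ∧ m ∉ P)
    (ρ : V →ₗ[U] U) (hρ : ∀ v, algebraMap U V (ρ v) = e 0 v) :
    Module.Finite V (((ModuleCat.restrictScalars (algebraMap U V)).obj (ModuleCat.of V V)) →ₗ[U] U) ∧
      Module.Projective V (((ModuleCat.restrictScalars (algebraMap U V)).obj (ModuleCat.of V V)) →ₗ[U] U) :=
  finite_projective_of_reynoldsPairing ρ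
    (pairing_existsUnique_of_graded e he_sum he_proj he_mul he_one he_zero hinj hbig ρ hρ)

/-- **THE GRADED T-V FLOOR WITH STANDARD HYPOTHESES (every characteristic).**  `U` noetherian, `V` a noetherian
normal domain finitely graded over `U = V₀` (projectors `eₓ`, `e₀ 1 = 1`, degree-`0` part `ρ`, `algebraMap`
injective) with (BIG); `c ∈ ca³(V)`, `a = ∑ₖ bₖ b′ₖ` with `b′ₖ ∈ V_{−x}` for every `x`, `algebraMap u = a c`.  Then
**`u ∈ ca³(U)`**.  (Stub-4's `mul_mem_cohomologyAnnihilatorOfDegree_three_of_isIntegrallyClosed_group` without the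
group, the characters, `|G| ∈ Uˣ` or a root of unity — the form the `p ∣ n` cyclic arrivals need.) [this work] -/
theorem mul_mem_cohomologyAnnihilatorOfDegree_three_of_graded [IsNoetherianRing U] (e : G → (V →ₗ[U] V))
    (he_sum : ∀ w, ∑ x, e x w = w) (he_proj : ∀ x y w, e x (e y w) = if x = y then e y w else 0)
    (he_mul : ∀ x y (v w : V), e x v = v → e y w = w → e (x + y) (v * w) = v * w) (he_one : e 0 1 = 1)
    (he_zero : ∀ v, e 0 v = v → ∃ r : U, algebraMap U V r = v) (hinj : Function.Injective (algebraMap U V))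
    (hbig : ∀ (x : G) (P : Ideal V), P.IsPrime → P.height = 1 → ∃ m : V, e x m = m ∧ m ∉ P)
    (ρ : V →ₗ[U] U) (hρ : ∀ v, algebraMap U V (ρ v) = e 0 v)
    {c : V} (hc3 : c ∈ cohomologyAnnihilatorOfDegree V 3) {a : V} (n : G → ℕ)
    (b b' : (x : G) → Fin (n x) → V) (hb' : ∀ x k, e (-x) (b' x k) = b' x k) (hsum : ∀ x, ∑ k, b x k * b' x k = a)
    (u : U) (hu : algebraMap U V u = a * c) : u ∈ cohomologyAnnihilatorOfDegree U 3 := by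
  obtain ⟨hfin, hproj⟩ := finite_projective_coind_of_graded e he_sum he_proj he_mul he_one he_zero hinj hbig ρ hρ
  haveI := hfin
  haveI := hproj
  have hρ1 : ρ 1 = 1 := hinj (by rw [hρ, he_one, map_one])
  exact mul_mem_cohomologyAnnihilatorOfDegree_three_graded e he_sum he_proj he_mul ρ hρ hρ1 hc3 n b b' hb' hsum u hu

/-- **The same, `ca`-form.** [this work] -/
theorem mul_mem_cohomologyAnnihilator_of_graded [IsNoetherianRing U] (e : G → (V →ₗ[U] V))
    (he_sum : ∀ w, ∑ x, e x w = w) (he_proj : ∀ x y w, e x (e y w) = if x = y then e y w else 0)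
    (he_mul : ∀ x y (v w : V), e x v = v → e y w = w → e (x + y) (v * w) = v * w) (he_one : e 0 1 = 1)
    (he_zero : ∀ v, e 0 v = v → ∃ r : U, algebraMap U V r = v) (hinj : Function.Injective (algebraMap U V))
    (hbig : ∀ (x : G) (P : Ideal V), P.IsPrime → P.height = 1 → ∃ m : V, e x m = m ∧ m ∉ P)
    (ρ : V →ₗ[U] U) (hρ : ∀ v, algebraMap U V (ρ v) = e 0 v)
    {c : V} (hc3 : c ∈ cohomologyAnnihilatorOfDegree V 3) {a : V} (n : G → ℕ)
    (b b' : (x : G) → Fin (n x) → V) (hb' : ∀ x k, e (-x) (b' x k) = b' x k) (hsum : ∀ x, ∑ k, b x k * b' x k = a)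
    (u : U) (hu : algebraMap U V u = a * c) : u ∈ cohomologyAnnihilator U :=
  cohomologyAnnihilatorOfDegree_le (R := U) 3 (mul_mem_cohomologyAnnihilatorOfDegree_three_of_graded e he_sum he_proj
    he_mul he_one he_zero hinj hbig ρ hρ hc3 n b b' hb' hsum u hu)

end Normal

end Summit.ResolutionOfSingularities.ResolutionOfSingularities.Theorems.HomologicalConductor.PersistenceGradedTransfer

end
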